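import Literature.AlgebraicGeometry.CossartPiltant200819.Thm21ProjectiveMorphisms2008
import Literature.AlgebraicGeometry.CossartPiltant200819.Thm21VerbatimBlowupProjective2008
import Literature.AlgebraicGeometry.Resolution.ResolutionOfComponentsRegularLocus
import Literature.AlgebraicGeometry.Resolution.PrincipalizationToResolution
import Literature.AlgebraicGeometry.Resolution.ResolvingSystems
import HarnessLib

/-!
# Cossart–Piltant 2008, Thm. 2.1 VERBATIM — every reduced quasi-projective `Z`, from the
printed leaves

Topic: `Literature/AlgebraicGeometry/CossartPiltant200819`.  This module closes the last edge of
the verbatim skeleton of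

  V. Cossart, O. Piltant, *Resolution of singularities of threefolds in positive
  characteristic. I*, J. Algebra 320 (2008) 1051–1082, **Theorem 2.1** (HAL hal-00139124,
  p. 3), PRINTED TEXT: "Let `k` be a field of positive characteristic which is differentially
  finite over a perfect field `k₀`, i.e. `Ω¹_{k/k₀}` has finite dimension. Let `Z/k` be a
  reduced quasiprojective scheme of dimension three with singular locus `Σ`. There exists a
  projective morphism `π : Z̃ → Z`, such that (i) `Z̃` is regular. (ii) `π` induces an
  isomorphism `Z̃ ∖ π⁻¹(Σ) ≃ Z ∖ Σ`. (iii) `π⁻¹(Σ) ⊂ Z̃` is a divisor with strict normal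
  crossings."

  PRINTED PROOF, first paragraph: "Let `Z₁, …, Z_s` be the distinct irreducible components of
  `Z`. If `s ≥ 2`, let `η : Z' → Z` be the blowing up along the scheme theoretic intersection
  `Z₁ ∩ (Z₂ ∪ ⋯ ∪ Z_s)`. Note that `η` induces an isomorphism away from the singular locus of
  `Z` and that the strict transform of `Z₁` is a connected component of `Z'`. By induction on
  `s`, we reduce to the case when `Z` is irreducible. Since the theorem is true in dimension
  less than or equal to two [36], we assume that `Z` has dimension three.  Once (i) and (ii)
  have been proved, (iii) follows from proposition 4.1. By proposition 4.9, it is sufficient to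
  prove local uniformization …"

namely the tree's VERBATIM rendering `CP2008.ResolutionQuasiProjectiveThreefolds`
(`Thm21Verbatim2008.lean`: ALL reduced quasi-projective `Z/k` of dimension three, `π` a
projective morphism in the sense of Hartshorne II §4) from the PRINTED LEAVES:

* `CP2008.RefinedPatchingQuasiProjective` — Prop. 4.9 (NAMED FACT, `RefinedPatchingVerbatim2008`);
* `CP2008.LU3DiffFinite` — local uniformization in dimension three, the conclusion of §§5–9 and
  [CP-II] (a `def`, itself derived from the printed leaves Prop. 5.1, Thm. 6.3, Prop. 8.3,
  Thm. 9.3, Thm. 9.4 and [CP-II] in `RamificationDescent2008.lean`, or from Cossart–Piltant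
  2019 in `Bridge2019.lean` — both variants are recorded below);
* `Resolution.CossartJannsenSaito2020Embedded` — embedded resolution of surfaces, through which
  the tree renders Prop. 4.1 / (iii) (`exists_isBlowup_isGoodResolution_comp`);
* `Resolution.CossartJannsenSaito2020Sequence` — reference [36] (Lipman 1978) in the form of
  Cossart–Jannsen–Saito's Thm. 1: a desingularization of a reduced excellent scheme of
  dimension `≤ 2` by a finite sequence of blowing ups in singular centres
  (`Thm21ProjectiveMorphisms2008.lean`).

The integral case of dimension three is `Thm21VerbatimAssembly2008.lean` /
`Thm21VerbatimBlowupProjective2008.lean` (where Hartshorne II 7.10 (b), "the blowing up of a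
quasi-projective scheme is a projective morphism", is PROVED as
`CP2008.BlowupProjectiveOverQuasiProjective_holds`).  What this module adds is the printed
first paragraph — the REDUCTION TO THE IRREDUCIBLE CASE with projectivity of `π` kept track of —
and the case of dimension `≤ 2`:

PROOF RENDERED.  (1) `IsSingularBlowupSequence.isProjectiveOver_of_isQuasiProjectiveOver`: a
finite sequence of blowing ups of a quasi-projective `k`-scheme is a projective morphism
(induction; each step is II 7.10 (b) and projective morphisms compose) — so [36] gives a
PROJECTIVE resolution of every quasi-projective `k`-scheme of dimension `≤ 2`.
(2) `isResolution_coprodDesc_of_closed_cover`: for a closed cover `X = C ∪ D` of a reduced scheme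
with `C ∖ D ⊆ C`, `D ∖ C ⊆ D` dense and no regular point of `X` on `C ∩ D`, resolutions of `C`
and `D` which are isomorphisms over exactly the regular loci give the resolution
`C' ⨿ D' → X`, an isomorphism over exactly `Reg X` — the tree's
`Resolution.exists_isResolution_regularLocus_of_closed_cover` with the construction exposed, so
that (3) `exists_isProjectiveOver_isResolution_of_irreducibleComponents` can carry
projectivity through the induction on the number `s` of irreducible components
(`IsProjectiveOver.coprodDesc`, `.of_isClosedImmersion`, `.comp` of
`Thm21ProjectiveMorphisms2008.lean`).  (4) `exists_isProjectiveOver_isResolution_of_isIntegral`: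
the irreducible case, dimension `3` by Cossart–Piltant (Prop. 4.9 + (LU)), dimension `≤ 2` by
[36] and (1).  (5) `exists_verbatim_reduced_of_leaves`: (iii) by one more blowing up
(`exists_isBlowup_isGoodResolution_comp`), projective by II 7.10 (b); whence
`resolutionQuasiProjectiveThreefolds_of_leaves : … → ResolutionQuasiProjectiveThreefolds`.

DEVIATION (recorded, not hidden).  The printed text separates `Z₁` from `Z₂ ∪ ⋯ ∪ Z_s` by the
blowing up `η` of their scheme-theoretic intersection and inducts inside `Z'`; this module
uses instead the disjoint union `Z₁ ⨿ (Z₂ ∪ ⋯ ∪ Z_s) → Z` of the two reduced closed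
subschemes (a projective morphism, an isomorphism off `Z₁ ∩ (Z₂ ∪ ⋯ ∪ Z_s) ⊆ Σ`), exactly as
the tree's treatment of [CP 2019] Prop. 4.6 Step 1 ("There is a finite birational morphism
`∐ᵢ 𝒳ᵢ → 𝒳`, isomorphic above `Reg 𝒳`").  Both devices replace `Z` by a scheme whose connected
pieces are the components, over which the theorem is proved piece by piece; the order
"(i)(ii) for the pieces, then (iii) by Prop. 4.1 on the whole" is the printed one.

CAVEAT (repair-cell rule): this is a typed transcription of published mathematics for audit
purposes; AI review is weaker than expert review; NOT summit progress.  No new named facts, no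
`sorry`.

## References

* [CossartPiltant2008] V. Cossart, O. Piltant, J. Algebra 320 (2008) 1051–1082, Thm. 2.1 and its
  proof (HAL hal-00139124, p. 3); Prop. 4.1, Prop. 4.9.
* [CossartPiltant2019] V. Cossart, O. Piltant, J. Algebra 529 (2019) 268–535, proof of Prop. 4.6,
  Step 1.
* [CossartJannsenSaito2020] V. Cossart, U. Jannsen, S. Saito, arXiv:0905.2191, Introduction
  Thm. 1; LNM 2270 (2020).
* [Lipman1978] J. Lipman, Ann. of Math. 107 (1978) 151–207.
* [Hartshorne1977] R. Hartshorne, *Algebraic Geometry*, GTM 52, II §4 (p. 103), II Prop. 7.10 (b),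
  II Ex. 4.9.
* [StacksProject] Tag 07QW (schemes of finite type over a field are excellent).
-/

noncomputable section

open CategoryTheory CategoryTheory.Limits AlgebraicGeometry TopologicalSpace

universe u

namespace Literature.AlgebraicGeometry.CossartPiltant200819.CP2008

open Literature.AlgebraicGeometry.Resolution

/-! ## A sequence of blowing ups over a quasi-projective base is projective -/

/-- **A finite sequence of blowing ups of a quasi-projective `k`-scheme is a projective
morphism, and its source is again quasi-projective** (induction on the sequence: each step is
Hartshorne II 7.10 (b), `BlowupProjectiveOverQuasiProjective_holds`, and projective morphisms
compose, Hartshorne II Ex. 4.9 / Segre).  This is how reference [36] — a desingularization of an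
excellent surface by successive blowing ups — yields the PROJECTIVE `π` of Thm. 2.1 in dimension
`≤ 2`. [cite: Hartshorne1977, II Prop. 7.10 (b); II Ex. 4.9] -/
theorem IsSingularBlowupSequence.isProjectiveOver_of_isQuasiProjectiveOver
    {k : Type u} [Field k] {X' X : Scheme.{u}} {π : X' ⟶ X} (hπ : IsSingularBlowupSequence π) :
    ∀ (f : X ⟶ Spec (.of k)), IsQuasiProjectiveOver f →
      IsQuasiProjectiveOver (π ≫ f) ∧ IsProjectiveOver f π := by
  induction hπ with
  | id X =>
    intro f hf
    exact ⟨by simpa using hf, IsProjectiveOver.id f⟩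
  | comp hσ hD hπ ih =>
    intro f hf
    obtain ⟨hq, hp⟩ := ih f hf
    obtain ⟨hq', hp'⟩ := isQuasiProjectiveOver_comp_of_isBlowup hq hσ
    exact ⟨by simpa only [Category.assoc] using hq', hp'.comp hp⟩

/-! ## Gluing resolutions of a closed cover, with the construction exposed -/

/-- **Resolutions of the two pieces of a closed cover glue to a resolution — the disjoint
union** (the tree's `Resolution.exists_isResolution_regularLocus_of_closed_cover`, with the
constructed morphism `C' ⨿ D' → X` EXPOSED so that its projectivity can be read off): `X`
reduced, `X = C ∪ D` with `C ∖ D` dense in `C`, `D ∖ C` dense in `D`, no regular point of `X` on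
both; if `ρ₁ : C' → C`, `ρ₂ : D' → D` are resolutions which are isomorphisms over exactly the
regular loci, then `coprod.desc (ρ₁ ≫ ι₁) (ρ₂ ≫ ι₂) : C' ⨿ D' → X` is a resolution which is an
isomorphism over exactly `Reg X = (Reg C ∖ D) ∪ (Reg D ∖ C)`.  Proof transcribed from loc. cit.
(Cossart–Piltant's induction on the number `s` of irreducible components, [CP-I] proof of
Thm. 2.1 / [CP 2019] proof of Prop. 4.6 Step 1).
[cite: CossartPiltant2008, proof of Thm. 2.1 (HAL p. 3)] -/
theorem isResolution_coprodDesc_of_closed_cover {C D X C' D' : Scheme.{u}} [IsReduced X]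
    (ι₁ : C ⟶ X) (ι₂ : D ⟶ X) [IsClosedImmersion ι₁] [IsClosedImmersion ι₂]
    (hcov : Set.range ι₁ ∪ Set.range ι₂ = Set.univ)
    (hd₁ : Dense (ι₁ ⁻¹' (Set.range ι₂)ᶜ)) (hd₂ : Dense (ι₂ ⁻¹' (Set.range ι₁)ᶜ))
    (hreg : ∀ x ∈ Scheme.regularLocus X, x ∈ Set.range ι₁ → x ∉ Set.range ι₂)
    {ρ₁ : C' ⟶ C} (hρ₁ : IsResolution ρ₁) {U₁ : C.Opens}
    (hU₁ : (U₁ : Set C) = Scheme.regularLocus C) (hiso₁ : IsIso (ρ₁ ∣_ U₁))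
    {ρ₂ : D' ⟶ D} (hρ₂ : IsResolution ρ₂) {U₂ : D.Opens}
    (hU₂ : (U₂ : Set D) = Scheme.regularLocus D) (hiso₂ : IsIso (ρ₂ ∣_ U₂)) :
    IsResolution (coprod.desc (ρ₁ ≫ ι₁) (ρ₂ ≫ ι₂)) ∧
      ∃ U : X.Opens, (U : Set X) = Scheme.regularLocus X ∧
        IsIso (coprod.desc (ρ₁ ≫ ι₁) (ρ₂ ≫ ι₂) ∣_ U) := by
  obtain ⟨hpr₁, ⟨W₁, -, hW₁', hisoW₁⟩, hreg₁⟩ := hρ₁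
  obtain ⟨hpr₂, ⟨W₂, -, hW₂', hisoW₂⟩, hreg₂⟩ := hρ₂
  -- the open complements of the two closed pieces
  let A : X.Opens := ⟨(Set.range ι₂)ᶜ, ι₂.isClosedEmbedding.isClosed_range.isOpen_compl⟩
  let B : X.Opens := ⟨(Set.range ι₁)ᶜ, ι₁.isClosedEmbedding.isClosed_range.isOpen_compl⟩
  have hA : (A : Set X) ⊆ Set.range ι₁ := by
    intro x hx
    have hx' : x ∈ Set.range ι₁ ∪ Set.range ι₂ := by rw [hcov]; trivial
    exact hx'.resolve_right hx
  have hB : (B : Set X) ⊆ Set.range ι₂ := by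
    intro x hx
    have hx' : x ∈ Set.range ι₁ ∪ Set.range ι₂ := by rw [hcov]; trivial
    exact hx'.resolve_left hx
  -- the closed immersions are isomorphisms over `A`, `B`; regular loci correspond there
  haveI eA : IsIso (ι₁ ∣_ A) := isIso_morphismRestrict_of_isClosedImmersion ι₁ A hA
  haveI eB : IsIso (ι₂ ∣_ B) := isIso_morphismRestrict_of_isClosedImmersion ι₂ B hB
  have regC : ∀ c : C, ι₁ c ∈ A →
      (c ∈ Scheme.regularLocus C ↔ ι₁ c ∈ Scheme.regularLocus X) :=
    fun c hc => mem_regularLocus_iff_of_isIso_morphismRestrict ι₁ A c hc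
  have regD : ∀ d : D, ι₂ d ∈ B →
      (d ∈ Scheme.regularLocus D ↔ ι₂ d ∈ Scheme.regularLocus X) :=
    fun d hd => mem_regularLocus_iff_of_isIso_morphismRestrict ι₂ B d hd
  -- opens of `X` inducing `U₁`, `U₂`
  obtain ⟨O₁, hO₁, hO₁U⟩ := ι₁.isClosedEmbedding.isInducing.isOpen_iff.mp U₁.2
  obtain ⟨O₂, hO₂, hO₂U⟩ := ι₂.isClosedEmbedding.isInducing.isOpen_iff.mp U₂.2
  let V₁ : X.Opens := ⟨O₁, hO₁⟩ ⊓ A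
  let V₂ : X.Opens := ⟨O₂, hO₂⟩ ⊓ B
  have hV₁U : ι₁ ⁻¹ᵁ V₁ ≤ U₁ := by
    intro c hc
    have hc' : ι₁ c ∈ O₁ := hc.1
    have : c ∈ ι₁ ⁻¹' O₁ := hc'
    rw [hO₁U] at this
    exact this
  have hV₂U : ι₂ ⁻¹ᵁ V₂ ≤ U₂ := by
    intro d hd
    have hd' : ι₂ d ∈ O₂ := hd.1
    have : d ∈ ι₂ ⁻¹' O₂ := hd'
    rw [hO₂U] at this
    exact this
  have hU₁V : ∀ c : C, c ∈ U₁ → ι₁ c ∈ A → ι₁ c ∈ V₁ := by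
    intro c hc hcA
    refine ⟨?_, hcA⟩
    have : c ∈ ι₁ ⁻¹' O₁ := by rw [hO₁U]; exact hc
    exact this
  have hU₂V : ∀ d : D, d ∈ U₂ → ι₂ d ∈ B → ι₂ d ∈ V₂ := by
    intro d hd hdB
    refine ⟨?_, hdB⟩
    have : d ∈ ι₂ ⁻¹' O₂ := by rw [hO₂U]; exact hd
    exact this
  -- `Reg X = V₁ ∪ V₂`
  have hRegX : ((V₁ ⊔ V₂ : X.Opens) : Set X) = Scheme.regularLocus X := by
    apply le_antisymm
    · rintro x (hx | hx)
      · obtain ⟨c, rfl⟩ := hA hx.2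
        have hc : c ∈ Scheme.regularLocus C := by
          rw [← hU₁]; exact hV₁U hx
        exact (regC c hx.2).mp hc
      · obtain ⟨d, rfl⟩ := hB hx.2
        have hd : d ∈ Scheme.regularLocus D := by
          rw [← hU₂]; exact hV₂U hx
        exact (regD d hx.2).mp hd
    · intro x hx
      have hx' : x ∈ Set.range ι₁ ∪ Set.range ι₂ := by rw [hcov]; trivial
      rcases hx' with ⟨c, rfl⟩ | ⟨d, rfl⟩
      · have hcA : ι₁ c ∈ A := hreg _ hx ⟨c, rfl⟩
        have hcU : c ∈ U₁ := by
          rw [← SetLike.mem_coe, hU₁]; exact (regC c hcA).mpr hx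
        exact Or.inl (hU₁V c hcU hcA)
      · by_cases hd : ι₂ d ∈ Set.range ι₁
        · exact absurd ⟨d, rfl⟩ (hreg _ hx hd)
        · have hdB : ι₂ d ∈ B := hd
          have hdU : d ∈ U₂ := by
            rw [← SetLike.mem_coe, hU₂]; exact (regD d hdB).mpr hx
          exact Or.inr (hU₂V d hdU hdB)
  -- the resolution: the disjoint union
  haveI := hpr₁
  haveI := hpr₂
  let π : C' ⨿ D' ⟶ X := coprod.desc (ρ₁ ≫ ι₁) (ρ₂ ≫ ι₂)
  have hπ₁ : ∀ c' : C', π ((coprod.inl : C' ⟶ C' ⨿ D') c') = ι₁ (ρ₁ c') := by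
    intro c'
    rw [← Scheme.Hom.comp_apply, coprod.inl_desc, Scheme.Hom.comp_apply]
  have hπ₂ : ∀ d' : D', π ((coprod.inr : D' ⟶ C' ⨿ D') d') = ι₂ (ρ₂ d') := by
    intro d'
    rw [← Scheme.Hom.comp_apply, coprod.inr_desc, Scheme.Hom.comp_apply]
  have hproper : IsProper π := isProper_coprodDesc _ _
  -- `π` is an isomorphism over `V₁ ∪ V₂`
  have hisoπ : IsIso (π ∣_ (V₁ ⊔ V₂)) := by
    refine isIso_morphismRestrict_sup π ?_ ?_
    · refine isIso_morphismRestrict_coprodDesc_left _ _ V₁ (fun d' h => ?_) ?_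
      · rw [Scheme.Hom.comp_apply] at h
        exact h.2 ⟨ρ₂ d', rfl⟩
      · rw [morphismRestrict_comp]
        have e1 : IsIso (ρ₁ ∣_ ι₁ ⁻¹ᵁ V₁) := isIso_morphismRestrict_of_le ρ₁ hiso₁ hV₁U
        have e2 : IsIso (ι₁ ∣_ V₁) :=
          isIso_morphismRestrict_of_isClosedImmersion ι₁ V₁ fun x hx => hA hx.2
        exact @IsIso.comp_isIso _ _ _ _ _ _ _ e1 e2
    · refine isIso_morphismRestrict_coprodDesc_right _ _ V₂ (fun c' h => ?_) ?_
      · rw [Scheme.Hom.comp_apply] at h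
        exact h.2 ⟨ρ₁ c', rfl⟩
      · rw [morphismRestrict_comp]
        have e1 : IsIso (ρ₂ ∣_ ι₂ ⁻¹ᵁ V₂) := isIso_morphismRestrict_of_le ρ₂ hiso₂ hV₂U
        have e2 : IsIso (ι₂ ∣_ V₂) :=
          isIso_morphismRestrict_of_isClosedImmersion ι₂ V₂ fun x hx => hB hx.2
        exact @IsIso.comp_isIso _ _ _ _ _ _ _ e1 e2
  -- the regular points of `C` off `D` are dense in `C` (and symmetrically)
  have hS₁ : Dense ((U₁ : Set C) ∩ ι₁ ⁻¹' (A : Set X)) := by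
    rw [dense_iff_inter_open]
    rintro O hO ⟨c, hc⟩
    obtain ⟨c₁, hc₁O, hc₁A⟩ := hd₁.inter_open_nonempty O hO ⟨c, hc⟩
    obtain ⟨O', hO', hO'O⟩ := ι₁.isClosedEmbedding.isInducing.isOpen_iff.mp hO
    have hne : (O' ∩ (A : Set X) ∩ Scheme.regularLocus X).Nonempty := by
      refine (Scheme.dense_regularLocus X).inter_open_nonempty (O' ∩ A) (hO'.inter A.2)
        ⟨ι₁ c₁, ?_, hc₁A⟩
      have : c₁ ∈ ι₁ ⁻¹' O' := by rw [hO'O]; exact hc₁O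
      exact this
    obtain ⟨x, ⟨hxO', hxA⟩, hxreg⟩ := hne
    obtain ⟨c₂, rfl⟩ := hA hxA
    refine ⟨c₂, ?_, ?_, hxA⟩
    · show c₂ ∈ O
      rw [← hO'O]; exact hxO'
    · rw [hU₁]; exact (regC c₂ hxA).mpr hxreg
  have hS₂ : Dense ((U₂ : Set D) ∩ ι₂ ⁻¹' (B : Set X)) := by
    rw [dense_iff_inter_open]
    rintro O hO ⟨d, hd⟩
    obtain ⟨d₁, hd₁O, hd₁B⟩ := hd₂.inter_open_nonempty O hO ⟨d, hd⟩
    obtain ⟨O', hO', hO'O⟩ := ι₂.isClosedEmbedding.isInducing.isOpen_iff.mp hO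
    have hne : (O' ∩ (B : Set X) ∩ Scheme.regularLocus X).Nonempty := by
      refine (Scheme.dense_regularLocus X).inter_open_nonempty (O' ∩ B) (hO'.inter B.2)
        ⟨ι₂ d₁, ?_, hd₁B⟩
      have : d₁ ∈ ι₂ ⁻¹' O' := by rw [hO'O]; exact hd₁O
      exact this
    obtain ⟨x, ⟨hxO', hxB⟩, hxreg⟩ := hne
    obtain ⟨d₂, rfl⟩ := hB hxB
    refine ⟨d₂, ?_, ?_, hxB⟩
    · show d₂ ∈ O
      rw [← hO'O]; exact hxO'
    · rw [hU₂]; exact (regD d₂ hxB).mpr hxreg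
  -- hence the preimage of `V₁ ∪ V₂` is dense upstairs
  have hT₁ : Dense (ρ₁ ⁻¹' ((W₁ : Set C) ∩ ((U₁ : Set C) ∩ ι₁ ⁻¹' (A : Set X)))) :=
    dense_preimage_inter_of_isIso_morphismRestrict ρ₁ hisoW₁ hW₁' hS₁
  have hT₂ : Dense (ρ₂ ⁻¹' ((W₂ : Set D) ∩ ((U₂ : Set D) ∩ ι₂ ⁻¹' (B : Set X)))) :=
    dense_preimage_inter_of_isIso_morphismRestrict ρ₂ hisoW₂ hW₂' hS₂
  have hdense : Dense ((π ⁻¹ᵁ (V₁ ⊔ V₂) : (C' ⨿ D').Opens) : Set ↑(C' ⨿ D')) := by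
    refine (dense_inl_image_union_inr_image hT₁ hT₂).mono ?_
    rintro z (⟨c', ⟨-, hc'U, hc'A⟩, rfl⟩ | ⟨d', ⟨-, hd'U, hd'B⟩, rfl⟩)
    · show π ((coprod.inl : C' ⟶ C' ⨿ D') c') ∈ V₁ ⊔ V₂
      rw [hπ₁]
      exact Or.inl (hU₁V _ hc'U hc'A)
    · show π ((coprod.inr : D' ⟶ C' ⨿ D') d') ∈ V₁ ⊔ V₂
      rw [hπ₂]
      exact Or.inr (hU₂V _ hd'U hd'B)
  haveI := hisoπ
  exact ⟨⟨hproper, isBirational_of_isIso_restrict π (V₁ ⊔ V₂) hRegX.ge hdense, hreg₁.coprod hreg₂⟩,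
    V₁ ⊔ V₂, hRegX, hisoπ⟩

/-! ## Projective resolutions from projective resolutions of the irreducible components -/

/-- **"By induction on `s`, we reduce to the case when `Z` is irreducible"** ([CP-I] proof of
Thm. 2.1, first paragraph), with PROJECTIVITY carried along: if every INTEGRAL quasi-projective
`k`-scheme of dimension `≤ 3` admits a resolution which is a projective morphism and an
isomorphism over exactly its regular locus, then so does every REDUCED quasi-projective
`k`-scheme `X` of dimension `≤ 3`.  Induction on the number of irreducible components of `X`
(the tree's `Resolution.exists_isResolution_regularLocus_of_irreducibleComponents`, re-run
with the structure morphism): split off one component `Z₁` (reduced structure, integral,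
quasi-projective as a closed subscheme) from the union `W` of the others, resolve both, and
take the disjoint union `Z₁' ⨿ W' → X` (`isResolution_coprodDesc_of_closed_cover`), a
projective morphism by `IsProjectiveOver.coprodDesc`.  DEVIATION from the printed text, which
passes through the blowing up `η` of `Z₁ ∩ (Z₂ ∪ ⋯ ∪ Z_s)` to separate `Z₁`: the disjoint union
`Z₁ ⨿ W → Z` is used directly (it is a projective morphism and an isomorphism off
`Z₁ ∩ W ⊆ Sing Z`, which is all the induction needs).
[cite: CossartPiltant2008, proof of Thm. 2.1 (HAL p. 3)] -/
theorem exists_isProjectiveOver_isResolution_of_irreducibleComponents {k : Type u} [Field k]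
    (hirr : ∀ (W : Scheme.{u}) [IsIntegral W] [IsNoetherian W] (g : W ⟶ Spec (.of k)),
      IsQuasiProjectiveOver g → topologicalKrullDim W ≤ 3 →
        ∃ (W' : Scheme.{u}) (ρ : W' ⟶ W), IsProjectiveOver g ρ ∧ IsResolution ρ ∧
          ∃ U : W.Opens, (U : Set W) = Scheme.regularLocus W ∧ IsIso (ρ ∣_ U))
    (X : Scheme.{u}) [IsNoetherian X] [IsReduced X] (f : X ⟶ Spec (.of k))
    (hf : IsQuasiProjectiveOver f) (hdim : topologicalKrullDim X ≤ 3) :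
    ∃ (X' : Scheme.{u}) (π : X' ⟶ X), IsProjectiveOver f π ∧ IsResolution π ∧
      ∃ U : X.Opens, (U : Set X) = Scheme.regularLocus X ∧ IsIso (π ∣_ U) := by
  -- strong induction on the number of irreducible components
  suffices key : ∀ (n : ℕ) (X : Scheme.{u}) [IsNoetherian X] [IsReduced X]
      (f : X ⟶ Spec (.of k)), IsQuasiProjectiveOver f → topologicalKrullDim X ≤ 3 →
      (irreducibleComponents X).ncard = n →
        ∃ (X' : Scheme.{u}) (π : X' ⟶ X), IsProjectiveOver f π ∧ IsResolution π ∧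
          ∃ U : X.Opens, (U : Set X) = Scheme.regularLocus X ∧ IsIso (π ∣_ U) from
    key _ X f hf hdim rfl
  intro n
  induction n using Nat.strong_induction_on with
  | _ n ih => ?_
  intro X _ _ f hf hdim hn
  rcases isEmpty_or_nonempty X with hXe | ⟨⟨x⟩⟩
  · -- the empty scheme is regular: the identity
    have hX : Scheme.IsRegular X := fun x => isEmptyElim x
    exact ⟨X, 𝟙 X, IsProjectiveOver.id f,
      ⟨inferInstance, ⟨⊤, by simp, by simp, inferInstance⟩, hX⟩,
      ⊤, by simp [hX.regularLocus_eq_univ], inferInstance⟩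
  -- the component `Z` of `x` and the union `Z'` of the other components
  have hfin : (irreducibleComponents X).Finite := NoetherianSpace.finite_irreducibleComponents
  set Z : Set X := irreducibleComponent x with hZdef
  have hZ : Z ∈ irreducibleComponents X := irreducibleComponent_mem_irreducibleComponents x
  set Others : Set (Set X) := irreducibleComponents X \ {Z} with hOthersdef
  have hOsub : Others ⊆ irreducibleComponents X := Set.sdiff_subset
  have hOfin : Others.Finite := hfin.subset hOsub
  have hOne : ∀ W ∈ Others, W ≠ Z := fun W hW h => hW.2 h
  set Z' : Set X := ⋃₀ Others with hZ'def
  have hZc : IsClosed Z := isClosed_of_mem_irreducibleComponents Z hZ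
  have hZ'c : IsClosed Z' := by
    rw [hZ'def, Set.sUnion_eq_biUnion]
    exact hOfin.isClosed_biUnion fun W hW => isClosed_of_mem_irreducibleComponents W (hOsub hW)
  have hZZ' : Z ∪ Z' = Set.univ := by
    rw [hZ'def, ← Set.sUnion_insert, hOthersdef, Set.insert_sdiff_singleton,
      Set.insert_eq_of_mem hZ, sUnion_irreducibleComponents]
  have hZnot : ¬ Z ⊆ Z' := fun h =>
    hOne Z (mem_of_subset_sUnion_irreducibleComponents Z hZ Others hOfin hOsub h) rfl
  have hWnot : ∀ W ∈ Others, ¬ W ⊆ Z := fun W hW h =>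
    hOne W hW ((h.antisymm ((hOsub hW).2 hZ.1 h)))
  -- the reduced closed subschemes `C ↪ X` on `Z` and `D ↪ X` on `Z'`
  set I₁ : X.IdealSheafData := Scheme.IdealSheafData.vanishingIdeal ⟨Z, hZc⟩ with hI₁
  set I₂ : X.IdealSheafData := Scheme.IdealSheafData.vanishingIdeal ⟨Z', hZ'c⟩ with hI₂
  have hr₁ : Set.range I₁.subschemeι = Z := range_subschemeι_vanishingIdeal ⟨Z, hZc⟩
  have hr₂ : Set.range I₂.subschemeι = Z' := range_subschemeι_vanishingIdeal ⟨Z', hZ'c⟩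
  haveI : IsReduced I₂.subscheme := isReduced_subscheme_vanishingIdeal _
  haveI : IsNoetherian I₁.subscheme := isNoetherian_subscheme _
  haveI : IsNoetherian I₂.subscheme := isNoetherian_subscheme _
  haveI : IsIntegral I₁.subscheme := isIntegral_subscheme_vanishingIdeal ⟨Z, hZc⟩ hZ.1
  -- the hypotheses of the glue
  have hcov : Set.range I₁.subschemeι ∪ Set.range I₂.subschemeι = Set.univ := by
    rw [hr₁, hr₂, hZZ']
  have hd₁ : Dense (I₁.subschemeι ⁻¹' (Set.range I₂.subschemeι)ᶜ) := by
    rw [hr₂]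
    refine IsOpen.dense (hZ'c.isOpen_compl.preimage I₁.subschemeι.continuous) ?_
    obtain ⟨z, hzZ, hzZ'⟩ := Set.not_subset.mp hZnot
    rw [← hr₁] at hzZ
    obtain ⟨c, rfl⟩ := hzZ
    exact ⟨c, hzZ'⟩
  have hd₂ : Dense (I₂.subschemeι ⁻¹' (Set.range I₁.subschemeι)ᶜ) := by
    rw [hr₁, dense_iff_inter_open]
    rintro O hO ⟨d, hd⟩
    obtain ⟨O', hO', hO'O⟩ := I₂.subschemeι.isClosedEmbedding.isInducing.isOpen_iff.mp hO
    have hdZ' : I₂.subschemeι d ∈ Z' := hr₂ ▸ Set.mem_range_self d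
    obtain ⟨W, hW, hdW⟩ := hdZ'
    have hWO' : (W ∩ O').Nonempty := ⟨_, hdW, by
      have : d ∈ I₂.subschemeι ⁻¹' O' := by rw [hO'O]; exact hd
      exact this⟩
    have hWZ : (W ∩ Zᶜ).Nonempty := Set.inter_compl_nonempty_iff.mpr (hWnot W hW)
    obtain ⟨y, hyW, hyO', hyZ⟩ := (hOsub hW).1.2 O' Zᶜ hO' hZc.isOpen_compl hWO' hWZ
    have hyZ' : y ∈ Set.range I₂.subschemeι := hr₂ ▸ ⟨W, hW, hyW⟩
    obtain ⟨d', rfl⟩ := hyZ'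
    refine ⟨d', ?_, hyZ⟩
    show d' ∈ O
    rw [← hO'O]; exact hyO'
  have hreg : ∀ y ∈ Scheme.regularLocus X, y ∈ Set.range I₁.subschemeι →
      y ∉ Set.range I₂.subschemeι := by
    intro y hy hy₁ hy₂
    rw [hr₁] at hy₁
    rw [hr₂] at hy₂
    obtain ⟨W, hW, hyW⟩ := hy₂
    haveI : IsRegularLocalRing (X.presheaf.stalk y) := hy
    haveI : IsDomain (X.presheaf.stalk y) := isDomain_of_isRegularLocalRing _
    exact hOne W hW (eq_of_mem_irreducibleComponents_of_isDomain_stalk y (hOsub hW) hZ hyW hy₁)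
  -- the two pieces are quasi-projective over `k` of dimension `≤ 3`
  have hq₁ : IsQuasiProjectiveOver (I₁.subschemeι ≫ f) :=
    hf.comp_isProjectiveOver (IsProjectiveOver.of_isClosedImmersion f I₁.subschemeι)
  have hq₂ : IsQuasiProjectiveOver (I₂.subschemeι ≫ f) :=
    hf.comp_isProjectiveOver (IsProjectiveOver.of_isClosedImmersion f I₂.subschemeι)
  have hdim₁ : topologicalKrullDim I₁.subscheme ≤ 3 :=
    I₁.subschemeι.isClosedEmbedding.isInducing.topologicalKrullDim_le.trans hdim
  have hdim₂ : topologicalKrullDim I₂.subscheme ≤ 3 :=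
    I₂.subschemeι.isClosedEmbedding.isInducing.topologicalKrullDim_le.trans hdim
  -- resolutions of the two pieces: `C` is integral, `D` has fewer components
  obtain ⟨C', ρ₁, hρ₁proj, hρ₁res, U₁, hU₁, hiso₁⟩ :=
    hirr I₁.subscheme (I₁.subschemeι ≫ f) hq₁ hdim₁
  have hlt : (irreducibleComponents I₂.subscheme).ncard < n := by
    have hle : (irreducibleComponents I₂.subscheme).ncard ≤ Others.ncard :=
      ncard_irreducibleComponents_le_of_isEmbedding
        I₂.subschemeι.isClosedEmbedding.isEmbedding hOsub hOfin hr₂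
    have hO : Others.ncard = n - 1 := by
      rw [hOthersdef, Set.ncard_sdiff_singleton_of_mem hZ, hn]
    have hn1 : 1 ≤ n := by
      rw [← hn]
      exact (Set.ncard_pos hfin).mpr ⟨Z, hZ⟩
    omega
  obtain ⟨D', ρ₂, hρ₂proj, hρ₂res, U₂, hU₂, hiso₂⟩ :=
    ih _ hlt I₂.subscheme (I₂.subschemeι ≫ f) hq₂ hdim₂ rfl
  obtain ⟨hres, U, hU, hiso⟩ := isResolution_coprodDesc_of_closed_cover I₁.subschemeι
    I₂.subschemeι hcov hd₁ hd₂ hreg hρ₁res hU₁ hiso₁ hρ₂res hU₂ hiso₂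
  exact ⟨_, coprod.desc (ρ₁ ≫ I₁.subschemeι) (ρ₂ ≫ I₂.subschemeι),
    IsProjectiveOver.coprodDesc
      (hρ₁proj.comp (IsProjectiveOver.of_isClosedImmersion f I₁.subschemeι))
      (hρ₂proj.comp (IsProjectiveOver.of_isClosedImmersion f I₂.subschemeι)),
    hres, U, hU, hiso⟩

/-! ## The irreducible case: dimension `3` by Cossart–Piltant, dimension `≤ 2` by [36] -/

/-- **Thm. 2.1 (i)(ii) with a projective `π`, for an INTEGRAL quasi-projective `Z/k` of
dimension `≤ 3`** ("we reduce to the case when `Z` is irreducible. Since the theorem is true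
in dimension less than or equal to two [36], we assume that `Z` has dimension three"):
in dimension `3` this is the integral case assembled in `Thm21VerbatimAssembly2008.lean`
(`exists_isProjectiveOver_isBlowup_isGoodResolution_of_leaves`: Prop. 4.9 + (LU), followed by
the blowing up making the exceptional locus a divisor — still projective by Hartshorne II 7.10
(b)); in dimension `≤ 2` it is [36] in the form `CossartJannsenSaito2020Sequence` (a sequence of
blowing ups in singular centres, projective over the quasi-projective `Z` by
`IsSingularBlowupSequence.isProjectiveOver_of_isQuasiProjectiveOver`; `Z` is excellent as a
scheme of finite type over a field, Stacks 07QW).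
[cite: CossartPiltant2008, proof of Thm. 2.1 (HAL p. 3)] [cite: Lipman1978, Theorem p. 151] -/
theorem exists_isProjectiveOver_isResolution_of_isIntegral
    (h49 : RefinedPatchingQuasiProjective.{u}) (hLU : LU3DiffFinite.{u})
    (hE : CossartJannsenSaito2020Embedded.{u}) (h36 : CossartJannsenSaito2020Sequence.{u})
    {p : ℕ} [Fact p.Prime] {k : Type u} [Field k] [CharP k p] (hk : IsDifferentiallyFinite k)
    (W : Scheme.{u}) [IsIntegral W] (g : W ⟶ Spec (.of k)) (hg : IsQuasiProjectiveOver g)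
    (hdim : topologicalKrullDim W ≤ 3) :
    ∃ (W' : Scheme.{u}) (ρ : W' ⟶ W), IsProjectiveOver g ρ ∧ IsResolution ρ ∧
      ∃ U : W.Opens, (U : Set W) = Scheme.regularLocus W ∧ IsIso (ρ ∣_ U) := by
  obtain ⟨hft, hsep, hqc⟩ := hg.finiteType_isSeparated_quasiCompact
  haveI := hft; haveI := hsep; haveI := hqc
  haveI : IsNoetherian W := Scheme.isNoetherian_of_finiteType_over_field g
  rcases le_two_or_eq_three_of_le_three hdim with h2 | h3
  · -- dimension `≤ 2`: [36]
    have hexc : Scheme.IsExcellent W :=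
      Scheme.isExcellent_of_locallyOfFiniteType Stacks07QW_field_holds g
    obtain ⟨W', ρ, hres, hseq, U, hU, hiso⟩ := h36 W hexc h2
    exact ⟨W', ρ,
      (IsSingularBlowupSequence.isProjectiveOver_of_isQuasiProjectiveOver hseq g hg).2,
      hres, U, hU, hiso⟩
  · -- dimension `3`: Cossart–Piltant
    obtain ⟨W', ρ, Q, W'', σ, hρproj, hσ, hgood⟩ :=
      exists_isProjectiveOver_isBlowup_isGoodResolution_of_leaves h49 hLU hE hk g hg h3
    have hq : IsQuasiProjectiveOver (ρ ≫ g) := hg.comp_isProjectiveOver hρproj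
    obtain ⟨-, hσproj⟩ := isQuasiProjectiveOver_comp_of_isBlowup hq hσ
    obtain ⟨U, hU, hiso⟩ := hgood.isIso_restrict_regularLocus
    exact ⟨W'', σ ≫ ρ, hσproj.comp hρproj, hgood.isResolution, U, hU, hiso⟩

/-! ## [CP-I] Thm. 2.1 verbatim, for every reduced quasi-projective `Z` -/

/-- **[CP-I] Thm. 2.1, VERBATIM conclusion, for a REDUCED quasi-projective `Z/k` of dimension
three**, from the printed leaves: Prop. 4.9 (`RefinedPatchingQuasiProjective`), local
uniformization in dimension three (`LU3DiffFinite`, itself assembled from the printed leaves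
of §§5–9 and [CP-II] in `RamificationDescent2008.lean`), embedded resolution of surfaces
(`CossartJannsenSaito2020Embedded`, for (iii) via Prop. 4.1) and [36]
(`CossartJannsenSaito2020Sequence`).  Proof as printed: reduce to the irreducible components
(`exists_isProjectiveOver_isResolution_of_irreducibleComponents`), settle the integral case in
dimension `3` / `≤ 2` (`exists_isProjectiveOver_isResolution_of_isIntegral`), then make the
exceptional locus a strict normal crossings divisor by a further blowing up
(`exists_isBlowup_isGoodResolution_comp`, Prop. 4.1 in the form of the tree), which keeps `π`
projective (Hartshorne II 7.10 (b), `BlowupProjectiveOverQuasiProjective_holds`).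
[cite: CossartPiltant2008, Thm. 2.1 and its proof (HAL p. 3)] -/
theorem exists_verbatim_reduced_of_leaves
    (h49 : RefinedPatchingQuasiProjective.{u}) (hLU : LU3DiffFinite.{u})
    (hE : CossartJannsenSaito2020Embedded.{u}) (h36 : CossartJannsenSaito2020Sequence.{u})
    {p : ℕ} [Fact p.Prime] {k : Type u} [Field k] [CharP k p] (hk : IsDifferentiallyFinite k)
    {Z : Scheme.{u}} [IsReduced Z] (f : Z ⟶ Spec (.of k)) (hf : IsQuasiProjectiveOver f)
    (hdim : topologicalKrullDim Z = 3) :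
    ∃ (Z' : Scheme.{u}) (π : Z' ⟶ Z), IsProjectiveOver f π ∧
      Scheme.IsRegular Z' ∧
      (∃ U : Z.Opens, (U : Set Z) = Scheme.regularLocus Z ∧ IsIso (π ∣_ U)) ∧
      IsStrictNormalCrossingsDivisor Z' (π.base ⁻¹' (Scheme.regularLocus Z)ᶜ) := by
  obtain ⟨hft, hsep, hqc⟩ := hf.finiteType_isSeparated_quasiCompact
  haveI := hft; haveI := hsep; haveI := hqc
  haveI : IsNoetherian Z := Scheme.isNoetherian_of_finiteType_over_field f
  have hqe : Scheme.IsQuasiExcellent Z :=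
    (Scheme.isExcellent_of_locallyOfFiniteType Stacks07QW_field_holds f).isQuasiExcellent
  -- (i)(ii) with a projective `π₀`, by induction on the irreducible components
  obtain ⟨Z₀, π₀, hπ₀proj, hres₀, U, hU, hisoU⟩ :=
    exists_isProjectiveOver_isResolution_of_irreducibleComponents
      (fun W _ _ g hg hd =>
        exists_isProjectiveOver_isResolution_of_isIntegral h49 hLU hE h36 hk W g hg hd)
      Z f hf hdim.le
  -- (iii): one more blowing up (Prop. 4.1 / embedded resolution of the exceptional locus)
  obtain ⟨Q, Z', σ, hσ, hgood⟩ :=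
    exists_isBlowup_isGoodResolution_comp hE hqe hdim.le hres₀ hU hisoU
  have hq₀ : IsQuasiProjectiveOver (π₀ ≫ f) := hf.comp_isProjectiveOver hπ₀proj
  obtain ⟨-, hσproj⟩ := isQuasiProjectiveOver_comp_of_isBlowup hq₀ hσ
  exact ⟨Z', σ ≫ π₀, hσproj.comp hπ₀proj, hgood.isResolution.isRegular,
    hgood.isIso_restrict_regularLocus, hgood.isStrictNormalCrossingsDivisor_preimage_singularLocus⟩

/-- **EDGE: [CP-I] Thm. 2.1 VERBATIM (`ResolutionQuasiProjectiveThreefolds`, all reduced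
quasi-projective `Z`) from the printed leaves.** [cite: CossartPiltant2008, Thm. 2.1] -/
theorem resolutionQuasiProjectiveThreefolds_of_leaves
    (h49 : RefinedPatchingQuasiProjective.{u}) (hLU : LU3DiffFinite.{u})
    (hE : CossartJannsenSaito2020Embedded.{u}) (h36 : CossartJannsenSaito2020Sequence.{u}) :
    ResolutionQuasiProjectiveThreefolds.{u} := by
  intro p _ k _ _ hk Z f _ hf hdim
  exact exists_verbatim_reduced_of_leaves h49 hLU hE h36 hk f hf hdim

/-- **The same edge with (LU) assembled from the printed leaves of §§5–9 and [CP-II]**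
(`lu3DiffFinite_of_leaves'` of `RamificationDescent2008.lean`: Prop. 5.1, Thm. 6.3, Prop. 8.3,
Thm. 9.3, Thm. 9.4, [CP-II]). [cite: CossartPiltant2008, Thm. 2.1] -/
theorem resolutionQuasiProjectiveThreefolds_of_leaves'
    (h49 : RefinedPatchingQuasiProjective.{u}) (p51 : RankReduction.{u})
    (h63 : ClimbToInertiaField.{u}) (h83 : PrimeDegreeAscent.{u})
    (h93 : DescentBelowInertiaField.{u}) (h94 : TamePrimeDescent.{u})
    (cp2 : CossartPiltant2009Main.{u}) (hE : CossartJannsenSaito2020Embedded.{u})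
    (h36 : CossartJannsenSaito2020Sequence.{u}) :
    ResolutionQuasiProjectiveThreefolds.{u} :=
  resolutionQuasiProjectiveThreefolds_of_leaves h49
    (lu3DiffFinite_of_leaves' p51 h63 h83 h93 h94 cp2) hE h36

/-- **The same edge with local uniformization taken from Cossart–Piltant 2019**
(`CossartPiltant2019LU3`, through `lu3DiffFinite_of_cossartPiltant2019LU3` of
`Bridge2019.lean`). [cite: CossartPiltant2008, Thm. 2.1] [cite: CossartPiltant2019, Thm. 1.1] -/
theorem resolutionQuasiProjectiveThreefolds_of_cossartPiltant2019LU3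
    (h49 : RefinedPatchingQuasiProjective.{u}) (h19 : CossartPiltant2019LU3.{u})
    (hE : CossartJannsenSaito2020Embedded.{u}) (h36 : CossartJannsenSaito2020Sequence.{u}) :
    ResolutionQuasiProjectiveThreefolds.{u} :=
  resolutionQuasiProjectiveThreefolds_of_leaves h49 (lu3DiffFinite_of_cossartPiltant2019LU3 h19)
    hE h36

end Literature.AlgebraicGeometry.CossartPiltant200819.CP2008

end
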